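import Mathlib

/-!
# Stub `stub_noDefect` (S2 of K1), line `Sketch` of crux `SquareFromVoronoiHub` — Part 3:
# the explicit majorant along the schedule `ε = δ^{1/8}` tends to zero

Crux `Summit.CriticalPhenomena.CardyFormulaZ2.Theses.CardyFlipRusso.SquareFromVoronoiHub`
(stmt-CriticalPhenomena-6434), line `Sketch`, stub family K1, registered stub `stub_noDefect`;
registered sub-goal `stub_noDefect_part3`.  Pure real analysis (no probability): with
`s = δ^{1/32}` the thresholds of the no-defect vocabulary read `ε = δ^{1/8} = s⁴`,
`cellRad δ / ε = s⁻¹`, `sepRad δ / ε = s⁸`, `edgeLen δ / ε = s¹⁶`, the rescaled window has radius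
`L₀ s⁻⁴` and contains a disc of radius `t₀ s⁻⁴`; the fixed-scale failure bound of Part 2,
`2e^{-πt²} + (4L/a + 5)² e^{-πa²/2} + 2πL² · 2πb² + 2πL² · (2π(5a)²)² · 50π a l`, is then at most
the MAJORANT `2 e^{-π t₀² s⁻⁸} + (4L₀ + 5)² s⁻⁶ e^{-(π/2) s⁻²} + 4π² L₀² s⁸ + 250000 π⁴ L₀² s³`
(`bound_le_majorant`, for `0 < s ≤ 1`), which tends to `0` as `s → 0⁺` (`tendsto_majorant`, from
`uⁿ e^{-κ u^m} → 0`, `tendsto_pow_mul_exp_neg_mul_pow`); `tendsto_rpow_inv32_nhdsGT` is the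
change of variables `δ ↦ δ^{1/32}`.
-/

noncomputable section

namespace Summit.CriticalPhenomena.CardyFormulaZ2.Cruxes.SquareFromVoronoiHub.VoronoiBlocks.Faithful.NoDefect

open scoped Topology
open Set Filter Metric

/-- `u ↦ uⁿ e^{-κ u^m} → 0` at `+∞` for `κ > 0`, `m ≥ 1`. [folklore] -/
theorem tendsto_pow_mul_exp_neg_mul_pow {κ : ℝ} (hκ : 0 < κ) (n m : ℕ) (hm : 1 ≤ m) :
    Tendsto (fun u : ℝ => u ^ n * Real.exp (-(κ * u ^ m))) atTop (𝓝 0) := by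
  have hg : Tendsto (fun u : ℝ => (κ ^ n)⁻¹ * ((κ * u) ^ n * Real.exp (-(κ * u)))) atTop (𝓝 0) := by
    have := ((Real.tendsto_pow_mul_exp_neg_atTop_nhds_zero n).comp
      (tendsto_id.const_mul_atTop hκ)).const_mul (κ ^ n)⁻¹
    rw [mul_zero] at this
    exact this
  refine squeeze_zero' ?_ ?_ hg
  · filter_upwards [eventually_ge_atTop (0 : ℝ)] with u hu
    positivity
  filter_upwards [eventually_ge_atTop (1 : ℝ)] with u hu
  have hum : u ≤ u ^ m := le_self_pow₀ hu (by omega)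
  have hexp : Real.exp (-(κ * u ^ m)) ≤ Real.exp (-(κ * u)) :=
    Real.exp_le_exp.2 (neg_le_neg (mul_le_mul_of_nonneg_left hum hκ.le))
  have e : u ^ n = (κ ^ n)⁻¹ * (κ * u) ^ n := by
    rw [mul_pow]; field_simp
  calc u ^ n * Real.exp (-(κ * u ^ m)) ≤ u ^ n * Real.exp (-(κ * u)) :=
        mul_le_mul_of_nonneg_left hexp (by positivity)
    _ = (κ ^ n)⁻¹ * ((κ * u) ^ n * Real.exp (-(κ * u))) := by rw [e]; ring

/-- The explicit majorant of the failure probability along the schedule, as a function of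
`s = δ^{1/32}`, tends to `0` as `s → 0⁺`. [folklore] -/
theorem tendsto_majorant (L₀ t₀ : ℝ) (ht₀ : 0 < t₀) :
    Tendsto (fun s : ℝ => 2 * ((s⁻¹) ^ 0 * Real.exp (-(Real.pi * t₀ ^ 2 * (s⁻¹) ^ 8))) +
      (4 * L₀ + 5) ^ 2 * ((s⁻¹) ^ 6 * Real.exp (-(Real.pi / 2 * (s⁻¹) ^ 2))) +
      4 * Real.pi ^ 2 * L₀ ^ 2 * s ^ 8 + 250000 * Real.pi ^ 4 * L₀ ^ 2 * s ^ 3)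
      (𝓝[>] 0) (𝓝 0) := by
  have hA := (tendsto_pow_mul_exp_neg_mul_pow (by positivity : 0 < Real.pi * t₀ ^ 2) 0 8
    (by norm_num)).comp tendsto_inv_nhdsGT_zero
  have hB := (tendsto_pow_mul_exp_neg_mul_pow (by positivity : 0 < Real.pi / 2) 6 2
    (by norm_num)).comp tendsto_inv_nhdsGT_zero
  have hC : Tendsto (fun s : ℝ => s ^ 8) (𝓝[>] 0) (𝓝 0) := by
    have h := ((continuous_pow 8).tendsto (0 : ℝ)).mono_left (nhdsWithin_le_nhds (s := Ioi 0))
    simpa using h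
  have hD : Tendsto (fun s : ℝ => s ^ 3) (𝓝[>] 0) (𝓝 0) := by
    have h := ((continuous_pow 3).tendsto (0 : ℝ)).mono_left (nhdsWithin_le_nhds (s := Ioi 0))
    simpa using h
  have := ((hA.const_mul 2).add (hB.const_mul ((4 * L₀ + 5) ^ 2))).add
    ((hC.const_mul (4 * Real.pi ^ 2 * L₀ ^ 2)).add (hD.const_mul (250000 * Real.pi ^ 4 * L₀ ^ 2)))
  simp only [mul_zero, add_zero] at this
  refine this.congr fun s => ?_
  simp only [Function.comp]
  ring

/-- **The fixed-scale majorant along the schedule.**  With `s = δ^{1/32} ∈ (0, 1]`, i.e.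
`ε = s⁴`, `L = L₀ s⁻⁴`, `t = t₀ s⁻⁴`, `a = s⁻¹`, `b = s⁸`, `l = s¹⁶`, the bound of
`measureReal_not_noDefect_le` is at most the majorant of `tendsto_majorant`. [folklore] -/
theorem bound_le_majorant {L₀ t₀ s : ℝ} (hL₀ : 0 ≤ L₀) (hs : 0 < s) (hs1 : s ≤ 1) :
    2 * Real.exp (-(Real.pi * (t₀ * (s⁻¹) ^ 4) ^ 2)) +
      (4 * (L₀ * (s⁻¹) ^ 4) / s⁻¹ + 5) ^ 2 * Real.exp (-(Real.pi * (s⁻¹) ^ 2 / 2)) +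
      2 * Real.pi * (L₀ * (s⁻¹) ^ 4) ^ 2 * (2 * Real.pi * (s ^ 8) ^ 2) +
      2 * Real.pi * (L₀ * (s⁻¹) ^ 4) ^ 2 * (2 * Real.pi * (5 * s⁻¹) ^ 2) *
        (2 * Real.pi * (5 * s⁻¹) ^ 2 * (50 * Real.pi * s⁻¹ * s ^ 16)) ≤
    2 * ((s⁻¹) ^ 0 * Real.exp (-(Real.pi * t₀ ^ 2 * (s⁻¹) ^ 8))) +
      (4 * L₀ + 5) ^ 2 * ((s⁻¹) ^ 6 * Real.exp (-(Real.pi / 2 * (s⁻¹) ^ 2))) +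
      4 * Real.pi ^ 2 * L₀ ^ 2 * s ^ 8 + 250000 * Real.pi ^ 4 * L₀ ^ 2 * s ^ 3 := by
  have hs' : s ≠ 0 := hs.ne'
  have hu : 1 ≤ s⁻¹ := (one_le_inv₀ hs).2 hs1
  have hpi := Real.pi_pos
  refine add_le_add (add_le_add (add_le_add (le_of_eq ?_) ?_) (le_of_eq ?_)) (le_of_eq ?_)
  · rw [pow_zero, one_mul]
    congr 2; ring
  · have e1 : 4 * (L₀ * (s⁻¹) ^ 4) / s⁻¹ = 4 * L₀ * (s⁻¹) ^ 3 := by field_simp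
    have e2 : Real.exp (-(Real.pi * (s⁻¹) ^ 2 / 2)) = Real.exp (-(Real.pi / 2 * (s⁻¹) ^ 2)) := by
      congr 1; ring
    rw [e1, e2, ← mul_assoc]
    refine mul_le_mul_of_nonneg_right ?_ (Real.exp_nonneg _)
    have hu3 : 1 ≤ (s⁻¹) ^ 3 := one_le_pow₀ hu
    have h0 : 0 ≤ 4 * L₀ * (s⁻¹) ^ 3 + 5 := by positivity
    have h1 : 4 * L₀ * (s⁻¹) ^ 3 + 5 ≤ (4 * L₀ + 5) * (s⁻¹) ^ 3 := by nlinarith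
    calc (4 * L₀ * (s⁻¹) ^ 3 + 5) ^ 2 ≤ ((4 * L₀ + 5) * (s⁻¹) ^ 3) ^ 2 :=
          pow_le_pow_left₀ h0 h1 2
      _ = (4 * L₀ + 5) ^ 2 * (s⁻¹) ^ 6 := by ring
  · field_simp
    ring
  · field_simp
    ring

/-- `δ ↦ δ^{1/32}` maps `𝓝[>] 0` to `𝓝[>] 0`. [folklore] -/
theorem tendsto_rpow_inv32_nhdsGT :
    Tendsto (fun δ : ℝ => δ ^ (1 / 32 : ℝ)) (𝓝[>] 0) (𝓝[>] 0) := by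
  refine tendsto_nhdsWithin_iff.2 ⟨?_, ?_⟩
  · have h : Tendsto (fun δ : ℝ => δ ^ (1 / 32 : ℝ)) (𝓝 0) (𝓝 ((0 : ℝ) ^ (1 / 32 : ℝ))) :=
      (Real.continuousAt_rpow_const 0 (1 / 32) (Or.inr (by norm_num))).tendsto
    rw [Real.zero_rpow (by norm_num)] at h
    exact h.mono_left nhdsWithin_le_nhds
  · filter_upwards [self_mem_nhdsWithin] with δ hδ
    exact Real.rpow_pos_of_pos hδ _

/-! ### Registered sub-goal of the stub (Part 3) -/

/-- **Part 3 of stub `stub_noDefect`, registered sub-goal** (`--supports stmt-CriticalPhenomena-6434`):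
the majorant tends to zero (`tendsto_majorant`) as a closed statement. [folklore] -/
theorem stub_noDefect_part3 : ∀ (L₀ t₀ : ℝ), 0 < t₀ →
    Tendsto (fun s : ℝ => 2 * ((s⁻¹) ^ 0 * Real.exp (-(Real.pi * t₀ ^ 2 * (s⁻¹) ^ 8))) +
      (4 * L₀ + 5) ^ 2 * ((s⁻¹) ^ 6 * Real.exp (-(Real.pi / 2 * (s⁻¹) ^ 2))) +
      4 * Real.pi ^ 2 * L₀ ^ 2 * s ^ 8 + 250000 * Real.pi ^ 4 * L₀ ^ 2 * s ^ 3)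
      (𝓝[>] 0) (𝓝 0) :=
  tendsto_majorant

end Summit.CriticalPhenomena.CardyFormulaZ2.Cruxes.SquareFromVoronoiHub.VoronoiBlocks.Faithful.NoDefect

end
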